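import Summits.SmoothPoincare4.SmoothPoincare4.Theorems.SymplecticOrigamiGromovRecognitionRelEndStubTameJAux
import Literature.Geometry.Kaehler.ManifoldFormsChart
import Literature.Geometry.Riemannian.RiemannianMetricExists
import Mathlib
import HarnessLib

/-!
# Local `sf`-compatible endomorphism fields from a chart (the "chart transpose" of a `2`-form)
(helper file 6 for stub `stub_tameJ` of line `cross-cap-laurent`, crux `GromovRecognitionRelEnd`,
item stmt-SmoothPoincare4-11009)

The local input of the partition-of-unity argument for tame almost complex structures
(McDuff–Salamon (2017), Prop. 2.5.6 + §4.1, "`𝒥(M, ω)` is nonempty": locally `ω = g(A ·, ·)`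
for the coordinate metric `g`). On `ℝ⁴` the **Euclidean transpose** of a `2`-form `β` is the
endomorphism `T_β a = Σᵢ β(a, eᵢ) eᵢ`, characterised by `⟪T_β a, b⟫ = β(a, b)`
(`inner_formTranspose`); it depends smoothly on `β` (`contDiffOn_formTranspose_comp`) and is
injective where `β` is nondegenerate (`formTranspose_ne_zero`). For a smooth `2`-form `sf` on a
`4`-manifold `M` and a chart centre `x₀`, the local section

  `A₀(y) := φ_y⁻¹ ∘ T_{β(y)} ∘ φ_y`,  `β(y) = sf.inChart x₀ (extChartAt x₀ y)`, `φ_y` the tangent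
  trivialisation at `x₀`,

is a `C^∞` section of `End(TM)` over the chart domain (`contMDiffOn_chartTranspose`, registered
helper sub-goal `helper_chartTransposeSmooth`) and satisfies
`sf_y(v, A₀(y) w) = ⟪T (φ_y v), T (φ_y w)⟫` (`form_chartTranspose_apply`): the bilinear form
`sf_y(·, A₀(y) ·)` is symmetric, and positive definite where `sf` is nondegenerate
(`formTranspose_chart_ne_zero`).

Everything is proved; no definition, no named fact.

References: D. McDuff, D. Salamon, *Introduction to Symplectic Topology*, 3rd ed. (2017),
Prop. 2.5.6, §4.1 [McDuffSalamon2017]; F. Warner, *Foundations of Differentiable Manifolds and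
Lie Groups* (1983), 2.18 (local expression of a form) [Warner1983].
-/

noncomputable section

-- the registered namespace `Summit.SmoothPoincare4.SmoothPoincare4.Theorems…` repeats a component
set_option linter.dupNamespace false

open scoped Manifold ContDiff Topology RealInnerProductSpace
open Bundle Set Function Filter Literature.Geometry.Kaehler

namespace Summit.SmoothPoincare4.SmoothPoincare4.Theorems.GromovRecognitionRelEnd.CrossCapLaurent

/-! ### The Euclidean transpose of a `2`-form on `ℝ⁴` -/

/-- Coordinates of the Euclidean transpose: `(T_β a)ᵢ = β(a, eᵢ)`. [folklore] -/
theorem formTranspose_apply_coord (β : EuclideanSpace ℝ (Fin 4) [⋀^Fin 2]→L[ℝ] ℝ)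
    (a : EuclideanSpace ℝ (Fin 4)) (i : Fin 4) :
    (∑ j : Fin 4, (β.toContinuousMultilinearMap.toContinuousLinearMap
        ![(0 : EuclideanSpace ℝ (Fin 4)), EuclideanSpace.single j (1 : ℝ)] 0).smulRight
        (EuclideanSpace.single j (1 : ℝ))) a i = β ![a, EuclideanSpace.single i 1] := by
  have hup : ∀ j : Fin 4, Function.update ![(0 : EuclideanSpace ℝ (Fin 4)),
      EuclideanSpace.single j (1 : ℝ)] 0 a = ![a, EuclideanSpace.single j 1] := fun j ↦ by
    funext k; fin_cases k <;> rfl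
  simp [ContinuousLinearMap.smulRight_apply, hup, Finset.sum_apply, Pi.single_apply]

/-- **`⟪T_β a, b⟫ = β(a, b)`**: the Euclidean transpose represents the `2`-form. [folklore] -/
theorem inner_formTranspose (β : EuclideanSpace ℝ (Fin 4) [⋀^Fin 2]→L[ℝ] ℝ)
    (a b : EuclideanSpace ℝ (Fin 4)) :
    ⟪(∑ j : Fin 4, (β.toContinuousMultilinearMap.toContinuousLinearMap
        ![(0 : EuclideanSpace ℝ (Fin 4)), EuclideanSpace.single j (1 : ℝ)] 0).smulRight
        (EuclideanSpace.single j (1 : ℝ))) a, b⟫ = β ![a, b] := by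
  -- linearity of `β ![a, ·]`
  have hlin : ∀ x : EuclideanSpace ℝ (Fin 4), β ![a, x] =
      (β.toContinuousMultilinearMap.toContinuousLinearMap ![a, 0] 1) x := fun x ↦ by
    have : Function.update ![a, (0 : EuclideanSpace ℝ (Fin 4))] 1 x = ![a, x] := by
      funext k; fin_cases k <;> rfl
    simp [this]
  have hb : b = ∑ j : Fin 4, b j • EuclideanSpace.single j (1 : ℝ) := by
    conv_lhs => rw [← (EuclideanSpace.basisFun (Fin 4) ℝ).sum_repr b]
    simp
  conv_rhs => rw [hb, hlin, map_sum]
  simp only [map_smul, smul_eq_mul]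
  rw [PiLp.inner_apply]
  congr 1
  funext j
  rw [formTranspose_apply_coord, ← hlin]
  simp

/-- The transpose is injective where the form is nondegenerate: `T_β a ≠ 0` as soon as
`β(a, b) ≠ 0` for some `b`. [folklore] -/
theorem formTranspose_ne_zero (β : EuclideanSpace ℝ (Fin 4) [⋀^Fin 2]→L[ℝ] ℝ)
    {a : EuclideanSpace ℝ (Fin 4)} (h : ∃ b, β ![a, b] ≠ 0) :
    (∑ j : Fin 4, (β.toContinuousMultilinearMap.toContinuousLinearMap
        ![(0 : EuclideanSpace ℝ (Fin 4)), EuclideanSpace.single j (1 : ℝ)] 0).smulRight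
        (EuclideanSpace.single j (1 : ℝ))) a ≠ 0 := by
  obtain ⟨b, hb⟩ := h
  intro h0
  apply hb
  rw [← inner_formTranspose, h0, inner_zero_left]

/-- **Smooth dependence**: `y ↦ T_{f y}` is `C^n` on `s` when `f` is (a map into `End(ℝ⁴)` is
`C^n` iff its matrix entries `y ↦ f y (a, eᵢ)` are). [folklore] -/
theorem contDiffOn_formTranspose_comp {X : Type*} [NormedAddCommGroup X] [NormedSpace ℝ X]
    {f : X → EuclideanSpace ℝ (Fin 4) [⋀^Fin 2]→L[ℝ] ℝ} {s : Set X} {n : WithTop ℕ∞}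
    (hf : ContDiffOn ℝ n f s) :
    ContDiffOn ℝ n (fun y ↦ ∑ j : Fin 4, ((f y).toContinuousMultilinearMap.toContinuousLinearMap
        ![(0 : EuclideanSpace ℝ (Fin 4)), EuclideanSpace.single j (1 : ℝ)] 0).smulRight
        (EuclideanSpace.single j (1 : ℝ))) s := by
  refine contDiffOn_clm_apply.2 fun a ↦ contDiffOn_euclidean.2 fun i ↦ ?_
  simp_rw [formTranspose_apply_coord]
  exact (ContinuousAlternatingMap.apply ℝ (EuclideanSpace ℝ (Fin 4)) ℝ
    ![a, EuclideanSpace.single i 1]).contDiff.comp_contDiffOn hf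

/-! ### The chart transpose of a `2`-form on a `4`-manifold -/

variable {M : Type*} [TopologicalSpace M] [ChartedSpace (EuclideanSpace ℝ (Fin 4)) M]
  [IsManifold (𝓡 4) ∞ M]

/-- The chart representative of a smooth form is `C^∞` on the chart target. [folklore] -/
theorem contDiffOn_inChart_of_isSmoothForm (sf : MForm (𝓡 4) M ℝ 2) (hsf : IsSmoothForm sf)
    (x₀ : M) : ContDiffOn ℝ ∞ (sf.inChart x₀) (extChartAt (𝓡 4) x₀).target := by
  intro y hy
  set z := (extChartAt (𝓡 4) x₀).symm y with hz
  have hzs : z ∈ (extChartAt (𝓡 4) x₀).source := (extChartAt (𝓡 4) x₀).map_target hy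
  have hzy : extChartAt (𝓡 4) x₀ z = y := (extChartAt (𝓡 4) x₀).right_inv hy
  have h := MForm.SmoothAt.contDiffWithinAt_inChart hzs ((isSmoothForm_iff_smoothAt sf).1 hsf z)
  rw [hzy] at h
  simp only [ModelWithCorners.range_eq_univ] at h
  exact h.mono (subset_univ _)

/-- **The chart transpose is a smooth local section of `End(TM)`.** For a smooth `2`-form `sf`
and a chart centre `x₀`, `y ↦ φ_y⁻¹ ∘ T_{β(y)} ∘ φ_y` (`β(y) = sf.inChart x₀ (extChartAt x₀ y)`,
`φ_y` the tangent trivialisation at `x₀`) is `C^∞` over the chart domain of `x₀`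
(`contMDiffOn_endSection_conj` with the smooth matrix-valued `y ↦ T_{β(y)}`).
[cite: McDuffSalamon2017, Prop. 2.5.6] -/
theorem contMDiffOn_chartTranspose (sf : MForm (𝓡 4) M ℝ 2) (hsf : IsSmoothForm sf) (x₀ : M) :
    ContMDiffOn (𝓡 4) ((𝓡 4).prod 𝓘(ℝ, EuclideanSpace ℝ (Fin 4) →L[ℝ] EuclideanSpace ℝ (Fin 4))) ∞
      (fun y ↦ TotalSpace.mk' (EuclideanSpace ℝ (Fin 4) →L[ℝ] EuclideanSpace ℝ (Fin 4))
        (E := fun x : M ↦ TangentSpace (𝓡 4) x →L[ℝ] TangentSpace (𝓡 4) x) y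
        (((trivializationAt (EuclideanSpace ℝ (Fin 4)) (TangentSpace (𝓡 4)) x₀).symmL ℝ y).comp
          ((∑ j : Fin 4, ((sf.inChart x₀ (extChartAt (𝓡 4) x₀ y)).toContinuousMultilinearMap
              |>.toContinuousLinearMap ![(0 : EuclideanSpace ℝ (Fin 4)),
                EuclideanSpace.single j (1 : ℝ)] 0).smulRight (EuclideanSpace.single j (1 : ℝ))).comp
            ((trivializationAt (EuclideanSpace ℝ (Fin 4)) (TangentSpace (𝓡 4)) x₀).continuousLinearMapAt
              ℝ y)))) (chartAt (EuclideanSpace ℝ (Fin 4)) x₀).source := by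
  refine contMDiffOn_endSection_conj _ x₀ ?_
  have hg := contDiffOn_formTranspose_comp (contDiffOn_inChart_of_isSmoothForm sf hsf x₀)
  have h := (contMDiffOn_iff_contDiffOn.2 hg).comp (contMDiffOn_extChartAt (I := 𝓡 4) (x := x₀))
    (fun y hy ↦ (extChartAt (𝓡 4) x₀).map_source (by simpa using hy))
  exact h

omit [IsManifold (𝓡 4) ∞ M] in
/-- The chart representative evaluated on trivialised vectors: for `y` in the chart domain of
`x₀`, `(sf.inChart x₀ (extChartAt x₀ y)) (a, b) = sf_y(φ_y⁻¹ a, φ_y⁻¹ b)` (Warner (1983), 2.18).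
[cite: Warner1983, 2.18] -/
theorem inChart_extChartAt_apply [IsManifold (𝓡 4) ∞ M] (sf : MForm (𝓡 4) M ℝ 2) (x₀ : M) {y : M}
    (hy : y ∈ (chartAt (EuclideanSpace ℝ (Fin 4)) x₀).source) (a b : EuclideanSpace ℝ (Fin 4)) :
    sf.inChart x₀ (extChartAt (𝓡 4) x₀ y) ![a, b] =
      sf y ![(trivializationAt (EuclideanSpace ℝ (Fin 4)) (TangentSpace (𝓡 4)) x₀).symmL ℝ y a,
        (trivializationAt (EuclideanSpace ℝ (Fin 4)) (TangentSpace (𝓡 4)) x₀).symmL ℝ y b] := by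
  have hys : y ∈ (extChartAt (𝓡 4) x₀).source := by simpa using hy
  have hyt : extChartAt (𝓡 4) x₀ y ∈ (extChartAt (𝓡 4) x₀).target := (extChartAt (𝓡 4) x₀).map_source hys
  have hzy : (extChartAt (𝓡 4) x₀).symm (extChartAt (𝓡 4) x₀ y) = y := (extChartAt (𝓡 4) x₀).left_inv hys
  rw [sf.inChart_eq_of_mem_target hyt, hzy, ContinuousAlternatingMap.compContinuousLinearMap_apply,
    TangentBundle.symmL_trivializationAt_eq_core hy]
  congr 1
  funext k
  fin_cases k <;> rfl

/-- **`sf_y(v, A₀(y) w) = ⟪T (φ_y v), T (φ_y w)⟫`** for the chart transpose `A₀(y) = φ_y⁻¹ T φ_y`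
(`T` the Euclidean transpose of `sf` read in the chart at `x₀`): the bilinear form
`sf_y(·, A₀(y) ·)` is a Gram form, hence symmetric and nonnegative.
[cite: McDuffSalamon2017, Prop. 2.5.6] -/
theorem form_chartTranspose_apply (sf : MForm (𝓡 4) M ℝ 2) (x₀ : M) {y : M}
    (hy : y ∈ (chartAt (EuclideanSpace ℝ (Fin 4)) x₀).source) (v w : TangentSpace (𝓡 4) y) :
    sf y ![v, (((trivializationAt (EuclideanSpace ℝ (Fin 4)) (TangentSpace (𝓡 4)) x₀).symmL ℝ y).comp
          ((∑ j : Fin 4, ((sf.inChart x₀ (extChartAt (𝓡 4) x₀ y)).toContinuousMultilinearMap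
              |>.toContinuousLinearMap ![(0 : EuclideanSpace ℝ (Fin 4)),
                EuclideanSpace.single j (1 : ℝ)] 0).smulRight (EuclideanSpace.single j (1 : ℝ))).comp
            ((trivializationAt (EuclideanSpace ℝ (Fin 4)) (TangentSpace (𝓡 4)) x₀).continuousLinearMapAt
              ℝ y))) w] =
      ⟪(∑ j : Fin 4, ((sf.inChart x₀ (extChartAt (𝓡 4) x₀ y)).toContinuousMultilinearMap
          |>.toContinuousLinearMap ![(0 : EuclideanSpace ℝ (Fin 4)),
            EuclideanSpace.single j (1 : ℝ)] 0).smulRight (EuclideanSpace.single j (1 : ℝ)))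
          ((trivializationAt (EuclideanSpace ℝ (Fin 4)) (TangentSpace (𝓡 4)) x₀).continuousLinearMapAt ℝ y v),
        (∑ j : Fin 4, ((sf.inChart x₀ (extChartAt (𝓡 4) x₀ y)).toContinuousMultilinearMap
          |>.toContinuousLinearMap ![(0 : EuclideanSpace ℝ (Fin 4)),
            EuclideanSpace.single j (1 : ℝ)] 0).smulRight (EuclideanSpace.single j (1 : ℝ)))
          ((trivializationAt (EuclideanSpace ℝ (Fin 4)) (TangentSpace (𝓡 4)) x₀).continuousLinearMapAt ℝ y w)⟫ := by
  have hy' : y ∈ (trivializationAt (EuclideanSpace ℝ (Fin 4)) (TangentSpace (𝓡 4)) x₀).baseSet := by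
    simpa using hy
  rw [inner_formTranspose, inChart_extChartAt_apply sf x₀ hy,
    (trivializationAt (EuclideanSpace ℝ (Fin 4)) (TangentSpace (𝓡 4)) x₀).symmL_continuousLinearMapAt hy']
  rfl

/-- Where `sf` is nondegenerate the chart transpose is injective on `φ_y v`, `v ≠ 0`:
`T (φ_y v) ≠ 0`. [folklore] -/
theorem formTranspose_chart_ne_zero (sf : MForm (𝓡 4) M ℝ 2) (x₀ : M) {y : M}
    (hy : y ∈ (chartAt (EuclideanSpace ℝ (Fin 4)) x₀).source)
    (hnd : ∀ v : TangentSpace (𝓡 4) y, v ≠ 0 → ∃ w, sf y ![v, w] ≠ 0) {v : TangentSpace (𝓡 4) y}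
    (hv : v ≠ 0) :
    (∑ j : Fin 4, ((sf.inChart x₀ (extChartAt (𝓡 4) x₀ y)).toContinuousMultilinearMap
        |>.toContinuousLinearMap ![(0 : EuclideanSpace ℝ (Fin 4)),
          EuclideanSpace.single j (1 : ℝ)] 0).smulRight (EuclideanSpace.single j (1 : ℝ)))
      ((trivializationAt (EuclideanSpace ℝ (Fin 4)) (TangentSpace (𝓡 4)) x₀).continuousLinearMapAt ℝ y v) ≠ 0 := by
  have hy' : y ∈ (trivializationAt (EuclideanSpace ℝ (Fin 4)) (TangentSpace (𝓡 4)) x₀).baseSet := by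
    simpa using hy
  refine formTranspose_ne_zero _ ?_
  obtain ⟨w, hw⟩ := hnd v hv
  refine ⟨(trivializationAt (EuclideanSpace ℝ (Fin 4)) (TangentSpace (𝓡 4)) x₀).continuousLinearMapAt ℝ y w, ?_⟩
  rwa [inChart_extChartAt_apply sf x₀ hy,
    (trivializationAt (EuclideanSpace ℝ (Fin 4)) (TangentSpace (𝓡 4)) x₀).symmL_continuousLinearMapAt hy',
    (trivializationAt (EuclideanSpace ℝ (Fin 4)) (TangentSpace (𝓡 4)) x₀).symmL_continuousLinearMapAt hy']

/-! ### Registered helper sub-goal -/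

/-- **Registered helper sub-goal `helper_chartTransposeSmooth`** (`contMDiffOn_chartTranspose` for
`M : Type`): for a smooth `2`-form `sf` on a `4`-manifold and a chart centre `x₀`, the chart
transpose `y ↦ φ_y⁻¹ ∘ T_{sf read in the chart} ∘ φ_y` is a `C^∞` section of `End(TM)` over the
chart domain. [cite: McDuffSalamon2017, Prop. 2.5.6] -/
theorem helper_chartTransposeSmooth : ∀ (M : Type) [TopologicalSpace M]
    [ChartedSpace (EuclideanSpace ℝ (Fin 4)) M] [IsManifold (𝓡 4) ∞ M]
    (sf : Literature.Geometry.Kaehler.MForm (𝓡 4) M ℝ 2) (x₀ : M),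
    Literature.Geometry.Kaehler.IsSmoothForm sf →
    ContMDiffOn (𝓡 4) ((𝓡 4).prod 𝓘(ℝ, EuclideanSpace ℝ (Fin 4) →L[ℝ] EuclideanSpace ℝ (Fin 4))) ∞
      (fun y ↦ Bundle.TotalSpace.mk' (EuclideanSpace ℝ (Fin 4) →L[ℝ] EuclideanSpace ℝ (Fin 4))
        (E := fun x : M ↦ TangentSpace (𝓡 4) x →L[ℝ] TangentSpace (𝓡 4) x) y
        (((trivializationAt (EuclideanSpace ℝ (Fin 4)) (TangentSpace (𝓡 4)) x₀).symmL ℝ y).comp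
          ((∑ j : Fin 4, ((sf.inChart x₀ (extChartAt (𝓡 4) x₀ y)).toContinuousMultilinearMap
              |>.toContinuousLinearMap ![(0 : EuclideanSpace ℝ (Fin 4)),
                EuclideanSpace.single j (1 : ℝ)] 0).smulRight (EuclideanSpace.single j (1 : ℝ))).comp
            ((trivializationAt (EuclideanSpace ℝ (Fin 4)) (TangentSpace (𝓡 4)) x₀).continuousLinearMapAt
              ℝ y)))) (chartAt (EuclideanSpace ℝ (Fin 4)) x₀).source :=
  fun _ _ _ _ sf x₀ hsf ↦ contMDiffOn_chartTranspose sf hsf x₀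

end Summit.SmoothPoincare4.SmoothPoincare4.Theorems.GromovRecognitionRelEnd.CrossCapLaurent

end
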